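import Literature.MathematicalPhysics.QuantumManyBody.DiluteBoseGasUpperBound
import Mathlib.MeasureTheory.Constructions.HaarToSphere
import Mathlib.MeasureTheory.Function.JacobianOneDim
import Mathlib.MeasureTheory.Measure.Lebesgue.VolumeOfBalls
import Mathlib.MeasureTheory.Integral.IntegralEqImproper
import Mathlib.Analysis.SpecialFunctions.Integrals.Basic
import HarnessLib

/-!
# Basti–Cenatiempo–Schlein 2021, §3: the Lee–Huang–Yang integral
# `(1/(2(2π)³)) ∫_{ℝ³} [√(v⁴ + 16π𝔞v²) - v² - 8π𝔞 + (8π𝔞)²/(2v²)] dv = 4π𝔞 · (128/(15√π)) 𝔞^{3/2}`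

Topic `Literature/MathematicalPhysics/QuantumManyBody`, companion of `DiluteBoseGasUpperBound.lean`
(provefact `Literature.MathematicalPhysics.QuantumManyBody.BoseGas.BastiCenatiempoSchlein2021_upperBound`),
where the constant `lhyConstant = 128/(15√π)` of the Lee–Huang–Yang correction
`4πρ²𝔞 · (128/(15√π)) √(ρ𝔞³)` is *defined*. This file proves where it comes from.

In the proof of [BastiCenatiempoSchlein2021, Prop. 1.3] (§3, energy of the trial state), the
second-order contribution of the Bogoliubov transformation is the Riemann sum (3.21),
`(N^κ/2) ∑_{v ∈ 2πN^{-κ/2}ℤ³} [√(v⁴ + 16π𝔞v²) - v² - 8π𝔞 + (8π𝔞)²/(2v²)]`, and the paper concludes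
by "Recognizing that (3.21) defines a Riemann sum and explicitly computing
`(1/(2(2π)³)) ∫ dq [√(v⁴ + 16π𝔞v²) - v² - 8π𝔞 + (8π𝔞)²/(2v²)] = 4π𝔞 · (128/(15√π)) 𝔞^{3/2}`".
This is the classical Lee–Huang–Yang integral; we prove it as stated (`integral_lhyIntegrand`,
with `𝔞^{3/2}` written `√(𝔞³)` as in the vendored Theorem 1.1).

Proof: polar coordinates (`MeasureTheory.integral_fun_norm_addHaar` with `|B₁| = 4π/3`,
`EuclideanSpace.volume_ball_fin_three`), the scaling `v = √(8π𝔞)·s`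
(`MeasureTheory.integral_comp_mul_left_Ioi`, `lhyRadial_scaling`), and the one-dimensional integral
`∫₀^∞ (s³√(s²+2) - s⁴ - s² + 1/2) ds = 8√2/15` (`integral_lhyProfile`), which the substitution
`s = 1/t - t/2`, `t ∈ (0, √2)` (`image_inv_sub_half_Ioo`,
`MeasureTheory.integral_image_eq_integral_abs_deriv_smul`) turns into
`∫₀^{√2} (1/2 + t²/8 - t⁴/16) dt`. All identities used are unconditional (no integrability
hypotheses are needed for the change-of-variables and polar-coordinates formulas of Mathlib).

## Contents (all proved; no definitions, no named facts)

* `image_inv_sub_half_Ioo`, `integral_lhyProfile`, `lhyRadial_scaling`, `integral_lhyIntegrand`.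

## References

* [BastiCenatiempoSchlein2021] G. Basti, S. Cenatiempo, B. Schlein, *A new second-order upper bound
  for the ground state energy of dilute Bose gases*, Forum Math. Sigma 9 (2021) e74
  (arXiv:2101.06222), §3, (3.21) and the display following it (p. 13 of the arXiv text); (1.2) for
  the constant `128/(15√π)` [LHY 1957].
-/

noncomputable section

open MeasureTheory MeasureTheory.Measure Set Filter Metric
open scoped ENNReal NNReal Topology

namespace Literature.MathematicalPhysics.QuantumManyBody.BoseGas

/-- The substitution `s = 1/t - t/2` maps `(0, √2)` onto `(0, ∞)`. [folklore] -/
theorem image_inv_sub_half_Ioo :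
    (fun t : ℝ ↦ 1 / t - t / 2) '' Ioo 0 (Real.sqrt 2) = Ioi 0 := by
  have h2 : Real.sqrt 2 * Real.sqrt 2 = 2 := Real.mul_self_sqrt (by norm_num)
  have hs2 : 0 < Real.sqrt 2 := Real.sqrt_pos.2 (by norm_num)
  ext s
  simp only [mem_image, mem_Ioo, mem_Ioi]
  constructor
  · rintro ⟨t, ⟨ht0, ht2⟩, rfl⟩
    have ht22 : t * t < 2 := by nlinarith
    rw [sub_pos, div_lt_div_iff₀ (by norm_num) ht0]
    nlinarith
  · intro hs
    refine ⟨Real.sqrt (s ^ 2 + 2) - s, ⟨?_, ?_⟩, ?_⟩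
    · rw [sub_pos, Real.lt_sqrt hs.le]; nlinarith
    · rw [sub_lt_iff_lt_add, Real.sqrt_lt' (by positivity)]
      nlinarith
    · have hq : Real.sqrt (s ^ 2 + 2) * Real.sqrt (s ^ 2 + 2) = s ^ 2 + 2 := Real.mul_self_sqrt (by positivity)
      have hpos : 0 < Real.sqrt (s ^ 2 + 2) - s := by
        rw [sub_pos, Real.lt_sqrt hs.le]; nlinarith
      have hinv : 1 / (Real.sqrt (s ^ 2 + 2) - s) = (Real.sqrt (s ^ 2 + 2) + s) / 2 := by
        rw [div_eq_div_iff hpos.ne' two_ne_zero]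
        nlinarith
      rw [hinv]
      ring

/-- **The one-dimensional Lee–Huang–Yang integral**:
`∫₀^∞ (s³√(s²+2) - s⁴ - s² + 1/2) ds = 8√2/15` (substitute `s = 1/t - t/2`, `t ∈ (0, √2)`, under
which the integrand times `|ds/dt| = 1/t² + 1/2` becomes the polynomial `1/2 + t²/8 - t⁴/16`).
[cite: BastiCenatiempoSchlein2021, §3, the display "explicitly computing" before (3.22)] -/
theorem integral_lhyProfile :
    ∫ s in Ioi (0 : ℝ), (s ^ 3 * Real.sqrt (s ^ 2 + 2) - s ^ 4 - s ^ 2 + 1 / 2) = 8 * Real.sqrt 2 / 15 := by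
  have hs2 : 0 < Real.sqrt 2 := Real.sqrt_pos.2 (by norm_num)
  have h2 : Real.sqrt 2 * Real.sqrt 2 = 2 := Real.mul_self_sqrt (by norm_num)
  set φ : ℝ → ℝ := fun t ↦ 1 / t - t / 2 with hφ
  set φ' : ℝ → ℝ := fun t ↦ -(1 / t ^ 2) - 1 / 2 with hφ'
  have hderiv : ∀ t ∈ Ioo 0 (Real.sqrt 2), HasDerivWithinAt φ (φ' t) (Ioo 0 (Real.sqrt 2)) t := by
    intro t ht
    have ht0 : t ≠ 0 := ht.1.ne'
    have h1 : HasDerivAt (fun t : ℝ ↦ 1 / t) (-(1 / t ^ 2)) t := by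
      simpa [one_div] using (hasDerivAt_inv ht0)
    have h2' : HasDerivAt (fun t : ℝ ↦ t / 2) (1 / 2) t := by
      simpa using (hasDerivAt_id t).div_const 2
    exact (h1.sub h2').hasDerivWithinAt
  have hinj : InjOn φ (Ioo 0 (Real.sqrt 2)) := by
    intro t₁ ht₁ t₂ ht₂ h
    simp only [hφ] at h
    have h1 : 0 < t₁ := ht₁.1
    have h2' : 0 < t₂ := ht₂.1
    field_simp at h
    -- `(t₁ - t₂)(2 + t₁ t₂) = 0`
    have : (t₂ - t₁) * (2 + t₁ * t₂) = 0 := by nlinarith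
    rcases mul_eq_zero.1 this with h0 | h0
    · linarith
    · nlinarith
  have hcv := integral_image_eq_integral_abs_deriv_smul measurableSet_Ioo hderiv hinj
    (fun s : ℝ ↦ s ^ 3 * Real.sqrt (s ^ 2 + 2) - s ^ 4 - s ^ 2 + 1 / 2)
  rw [image_inv_sub_half_Ioo] at hcv
  rw [hcv]
  -- the integrand in the new variable is a polynomial
  have hpt : ∀ t ∈ Ioo 0 (Real.sqrt 2), |φ' t| • (fun s : ℝ ↦ s ^ 3 * Real.sqrt (s ^ 2 + 2) - s ^ 4 - s ^ 2 + 1 / 2) (φ t) =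
      1 / 2 + t ^ 2 / 8 - t ^ 4 / 16 := by
    intro t ht
    have ht0 : 0 < t := ht.1
    have habs : |φ' t| = 1 / t ^ 2 + 1 / 2 := by
      rw [hφ']
      simp only []
      rw [abs_of_neg (by have := one_div_pos.2 (pow_pos ht0 2); linarith)]
      ring
    have htne : t ≠ 0 := ht0.ne'
    have hsq : Real.sqrt ((1 / t - t / 2) ^ 2 + 2) = 1 / t + t / 2 := by
      rw [show (1 / t - t / 2) ^ 2 + 2 = (1 / t + t / 2) ^ 2 by field_simp; ring]
      exact Real.sqrt_sq (by positivity)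
    rw [habs, smul_eq_mul, hφ]
    simp only []
    rw [hsq]
    field_simp
    ring
  rw [setIntegral_congr_fun measurableSet_Ioo hpt, ← integral_Ioc_eq_integral_Ioo,
    ← intervalIntegral.integral_of_le hs2.le]
  -- evaluate
  have hI : ∫ t in (0 : ℝ)..Real.sqrt 2, (1 / 2 + t ^ 2 / 8 - t ^ 4 / 16) =
      Real.sqrt 2 / 2 + (Real.sqrt 2) ^ 3 / 24 - (Real.sqrt 2) ^ 5 / 80 := by
    rw [intervalIntegral.integral_sub, intervalIntegral.integral_add, intervalIntegral.integral_const,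
      intervalIntegral.integral_div, intervalIntegral.integral_div, integral_pow, integral_pow]
    · simp; ring
    all_goals first
      | exact intervalIntegrable_const
      | exact (continuous_pow _ |>.div_const _).intervalIntegrable _ _
      | exact (continuous_const.add (continuous_pow _ |>.div_const _)).intervalIntegrable _ _
  rw [hI]
  have h3 : Real.sqrt 2 ^ 3 = 2 * Real.sqrt 2 := by
    rw [pow_succ, pow_two, h2]
  have h5 : Real.sqrt 2 ^ 5 = 4 * Real.sqrt 2 := by
    rw [pow_succ, show Real.sqrt 2 ^ 4 = (Real.sqrt 2 * Real.sqrt 2) ^ 2 by ring, h2]; ring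
  rw [h3, h5]
  ring


/-- The radial profile after scaling: for `b, s > 0`,
`(√b s)² F_b(√b s) = b² (s³√(s²+2) - s⁴ - s² + 1/2)` where
`F_b(r) = √(r⁴ + 2br²) - r² - b + b²/(2r²)`. [folklore] -/
theorem lhyRadial_scaling {b s : ℝ} (hb : 0 < b) (hs : 0 < s) :
    (Real.sqrt b * s) ^ 2 * (Real.sqrt ((Real.sqrt b * s) ^ 4 + 2 * b * (Real.sqrt b * s) ^ 2) -
      (Real.sqrt b * s) ^ 2 - b + b ^ 2 / (2 * (Real.sqrt b * s) ^ 2)) =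
      b ^ 2 * (s ^ 3 * Real.sqrt (s ^ 2 + 2) - s ^ 4 - s ^ 2 + 1 / 2) := by
  have hb2 : Real.sqrt b ^ 2 = b := Real.sq_sqrt hb.le
  have e2 : (Real.sqrt b * s) ^ 2 = b * s ^ 2 := by rw [mul_pow, hb2]
  have e4 : (Real.sqrt b * s) ^ 4 = b ^ 2 * s ^ 4 := by
    rw [show (Real.sqrt b * s) ^ 4 = ((Real.sqrt b * s) ^ 2) ^ 2 by ring, e2]; ring
  have hq : Real.sqrt (s ^ 2 + 2) ^ 2 = s ^ 2 + 2 := Real.sq_sqrt (by positivity)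
  have hsqrt : Real.sqrt (b ^ 2 * s ^ 4 + 2 * b * (b * s ^ 2)) = b * s * Real.sqrt (s ^ 2 + 2) := by
    rw [show b ^ 2 * s ^ 4 + 2 * b * (b * s ^ 2) = (b * s * Real.sqrt (s ^ 2 + 2)) ^ 2 by
      rw [mul_pow, mul_pow, hq]; ring]
    exact Real.sqrt_sq (by positivity)
  rw [e4, e2, hsqrt]
  have hs0 : s ≠ 0 := hs.ne'
  field_simp

/-- **The Lee–Huang–Yang integral** (the origin of the constant `128/(15√π)`): for `𝔞 > 0`,
`(1/(2(2π)³)) ∫_{ℝ³} [√(v⁴ + 16π𝔞v²) - v² - 8π𝔞 + (8π𝔞)²/(2v²)] dv = 4π𝔞 · (128/(15√π)) 𝔞^{3/2}`,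
written as `∫ … = 2(2π)³ · 4π𝔞 · lhyConstant · √(𝔞³)`. Proof: polar coordinates
(`MeasureTheory.integral_fun_norm_addHaar`, `|B₁| = 4π/3`), the scaling `v = √(8π𝔞) s` and
`integral_lhyProfile`. [cite: BastiCenatiempoSchlein2021, §3, the display "explicitly computing" before (3.22)] -/
theorem integral_lhyIntegrand {𝔞 : ℝ} (h𝔞 : 0 < 𝔞) :
    ∫ v : Space, (Real.sqrt (‖v‖ ^ 4 + 16 * Real.pi * 𝔞 * ‖v‖ ^ 2) - ‖v‖ ^ 2 - 8 * Real.pi * 𝔞 +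
        (8 * Real.pi * 𝔞) ^ 2 / (2 * ‖v‖ ^ 2)) =
      2 * (2 * Real.pi) ^ 3 * (4 * Real.pi * 𝔞 * (lhyConstant * Real.sqrt (𝔞 ^ 3))) := by
  set b : ℝ := 8 * Real.pi * 𝔞 with hb
  have hb0 : 0 < b := by positivity
  set F : ℝ → ℝ := fun r ↦ Real.sqrt (r ^ 4 + 2 * b * r ^ 2) - r ^ 2 - b + b ^ 2 / (2 * r ^ 2) with hF
  have hFv : (fun v : Space ↦ Real.sqrt (‖v‖ ^ 4 + 16 * Real.pi * 𝔞 * ‖v‖ ^ 2) - ‖v‖ ^ 2 - 8 * Real.pi * 𝔞 +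
      (8 * Real.pi * 𝔞) ^ 2 / (2 * ‖v‖ ^ 2)) = fun v ↦ F ‖v‖ := by
    funext v
    simp only [hF, hb]
    congr 2
    ring
  rw [hFv, integral_fun_norm_addHaar volume F]
  have hdim : Module.finrank ℝ Space = 3 := by simp [Space]
  have hball : (volume : Measure Space).real (ball 0 1) = Real.pi * 4 / 3 := by
    rw [Measure.real, EuclideanSpace.volume_ball_fin_three]
    rw [ENNReal.ofReal_one, one_pow, one_mul, ENNReal.toReal_ofReal (by positivity)]
  rw [hdim, hball]
  -- the radial integral
  have hsb : 0 < Real.sqrt b := Real.sqrt_pos.2 hb0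
  have hrad : ∫ y in Ioi (0 : ℝ), y ^ (3 - 1) • F y = Real.sqrt b * (b ^ 2 * (8 * Real.sqrt 2 / 15)) := by
    have h := integral_comp_mul_left_Ioi (fun y ↦ y ^ (3 - 1) • F y) 0 hsb
    rw [mul_zero] at h
    have hpt : ∀ s ∈ Ioi (0 : ℝ), (Real.sqrt b * s) ^ (3 - 1) • F (Real.sqrt b * s) =
        b ^ 2 * (s ^ 3 * Real.sqrt (s ^ 2 + 2) - s ^ 4 - s ^ 2 + 1 / 2) := by
      intro s hs
      rw [smul_eq_mul, show (3 - 1 : ℕ) = 2 from rfl, hF]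
      exact lhyRadial_scaling hb0 hs
    rw [setIntegral_congr_fun measurableSet_Ioi hpt, integral_const_mul, integral_lhyProfile, smul_eq_mul] at h
    rw [eq_comm, inv_mul_eq_iff_eq_mul₀ hsb.ne'] at h
    exact h
  rw [hrad]
  -- the constants
  have hπ := Real.pi_pos
  set p : ℝ := Real.sqrt Real.pi with hp
  set q : ℝ := Real.sqrt 𝔞 with hq
  set r : ℝ := Real.sqrt 2 with hr
  have hp0 : 0 < p := Real.sqrt_pos.2 hπ
  have hq0 : 0 < q := Real.sqrt_pos.2 h𝔞
  have hp2 : p ^ 2 = Real.pi := Real.sq_sqrt hπ.le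
  have hq2 : q ^ 2 = 𝔞 := Real.sq_sqrt h𝔞.le
  have hr2 : r ^ 2 = 2 := Real.sq_sqrt (by norm_num)
  have hsqb : Real.sqrt b = 2 * r * p * q := by
    rw [hb, show 8 * Real.pi * 𝔞 = (2 * r * p * q) ^ 2 by
      rw [mul_pow, mul_pow, mul_pow, hp2, hq2, hr2]; ring]
    exact Real.sqrt_sq (by positivity)
  have hsq3 : Real.sqrt (𝔞 ^ 3) = 𝔞 * q := by
    rw [show 𝔞 ^ 3 = (𝔞 * q) ^ 2 by rw [mul_pow, hq2]; ring]
    exact Real.sqrt_sq (by positivity)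
  have hlhy : lhyConstant = 128 / (15 * p) := by rw [lhyConstant, hp]
  rw [hsqb, hsq3, hlhy, nsmul_eq_mul, smul_eq_mul, hb]
  rw [← hp2, ← hq2]
  field_simp
  ring_nf
  rw [hr2]
  ring

end Literature.MathematicalPhysics.QuantumManyBody.BoseGas

end
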